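import Literature.MathematicalPhysics.KineticTheory.InfiniteChainGibbsInvariance
import HarnessLib

/-!
# Normal form of an infinite-volume dynamics: the identity off the carrier

Topic `Literature/MathematicalPhysics/KineticTheory` (companion of `InfiniteChainDynamics`). The
structure `InfiniteChainDynamics P` constrains its flow only ON the carrier (outside it "`flow t` is
unconstrained", as its docstring says; Pozzoli–Raquépas set `τ_t = id` there). Every dynamics `D`
has a NORMAL FORM `D'` with the same carrier and the same orbits on it, which is the identity off the
carrier (`exists_normalForm`); if the carrier is measurable and `D` preserves a measure `μ` (which is
then carried by the carrier), so does `D'`, with literally the same current autocorrelation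
`currentCorrelation μ t` and the same `HasAbsConvergentCorrelation μ t` at every `t` (the flows agree
`μ`-a.e.). For the carrier `𝒳₀ = bmGood P` of Buttà–Marchioro (measurable:
`OscillatorChain.measurableSet_bmGood`) this puts an arbitrary `𝒳₀`-dynamics in the form assumed by
`OscillatorChain.exists_bmDynamics` and by the zero-wavenumber constructions (flows commuting with the
lattice symmetries EVERYWHERE); `exists_normalForm_pinnedChain` is the pinned anharmonic chain
instance. Everything is proved; tagged `[folklore]`. No definitions, no named facts.
-/

noncomputable section

open MeasureTheory Filter Set Function

namespace Literature.MathematicalPhysics.KineticTheory.HeatConduction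

namespace InfiniteChainDynamics

variable {P : OscillatorChain} (D : InfiniteChainDynamics P)

/-- **Normal form of a dynamics.** There is a dynamics `D'` with the same carrier, the same flow on
the carrier, and `D'.flow t σ = σ` off the carrier; if the carrier is measurable and every `D.flow t`
is measurable then so is every `D'.flow t`. [folklore] -/
theorem exists_normalForm :
    ∃ D' : InfiniteChainDynamics P, D'.carrier = D.carrier ∧
      (∀ (t : ℝ) (σ : ChainConfig), σ ∈ D.carrier → D'.flow t σ = D.flow t σ) ∧
      (∀ (t : ℝ) (σ : ChainConfig), σ ∉ D.carrier → D'.flow t σ = σ) ∧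
      (MeasurableSet D.carrier → ∀ t : ℝ, Measurable (D.flow t) → Measurable (D'.flow t)) := by
  classical
  let φ : ℝ → ChainConfig → ChainConfig := fun t σ => if σ ∈ D.carrier then D.flow t σ else σ
  have hon : ∀ (t : ℝ) (σ : ChainConfig), σ ∈ D.carrier → φ t σ = D.flow t σ := fun t σ hσ => by
    simp only [φ, if_pos hσ]
  have hoff : ∀ (t : ℝ) (σ : ChainConfig), σ ∉ D.carrier → φ t σ = σ := fun t σ hσ => by
    simp only [φ, if_neg hσ]
  refine ⟨⟨D.carrier, φ, ?_, ?_, ?_, ?_⟩, rfl, hon, hoff, ?_⟩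
  · intro t σ hσ
    rw [hon t σ hσ]
    exact D.mapsTo t hσ
  · intro σ hσ
    rw [hon 0 σ hσ]
    exact D.flow_zero σ hσ
  · intro σ hσ
    have e : (fun t => φ t σ) = fun t => D.flow t σ := funext fun t => hon t σ hσ
    rw [e]
    exact D.isSolution σ hσ
  · intro γ hγ hsol t
    rw [hon t (γ 0) (hγ 0)]
    exact D.unique γ hγ hsol t
  · intro hC t ht
    exact Measurable.ite hC ht measurable_id

/-- **Normal form of a measure-preserving dynamics.** If `D` preserves `μ` and its carrier is
measurable, the normal form `D'` (identity off the carrier) preserves `μ`, its flows agree with those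
of `D` `μ`-a.e., and the Green–Kubo objects coincide: `D'.currentCorrelation μ = D.currentCorrelation μ`
and `D'.HasAbsConvergentCorrelation μ t ↔ D.HasAbsConvergentCorrelation μ t` for every `t`. [folklore] -/
theorem exists_normalForm_preservesMeasure (hC : MeasurableSet D.carrier) {μ : Measure ChainConfig}
    (hD : D.PreservesMeasure μ) :
    ∃ D' : InfiniteChainDynamics P, D'.carrier = D.carrier ∧
      (∀ (t : ℝ) (σ : ChainConfig), σ ∈ D.carrier → D'.flow t σ = D.flow t σ) ∧
      (∀ (t : ℝ) (σ : ChainConfig), σ ∉ D.carrier → D'.flow t σ = σ) ∧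
      D'.PreservesMeasure μ ∧ (∀ t : ℝ, D'.flow t =ᵐ[μ] D.flow t) ∧
      (∀ t : ℝ, D'.currentCorrelation μ t = D.currentCorrelation μ t) ∧
      ∀ t : ℝ, D'.HasAbsConvergentCorrelation μ t ↔ D.HasAbsConvergentCorrelation μ t := by
  obtain ⟨D', hcar, hon, hoff, hmeas⟩ := D.exists_normalForm
  have hae : ∀ t : ℝ, D'.flow t =ᵐ[μ] D.flow t := fun t => by
    filter_upwards [hD.1] with σ hσ
    exact hon t σ hσ
  have hpres : D'.PreservesMeasure μ := by
    refine ⟨by rw [hcar]; exact hD.1, fun t => ⟨hmeas hC t (hD.2 t).measurable, ?_⟩⟩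
    rw [Measure.map_congr (hae t)]
    exact (hD.2 t).map_eq
  have hint : ∀ (t : ℝ) (x : ℤ),
      (fun σ => P.bondCurrentZ σ 0 * P.bondCurrentZ (D'.flow t σ) x) =ᵐ[μ]
        fun σ => P.bondCurrentZ σ 0 * P.bondCurrentZ (D.flow t σ) x := fun t x => by
    filter_upwards [hae t] with σ hσ
    rw [hσ]
  have hcorr : ∀ t : ℝ, D'.currentCorrelation μ t = D.currentCorrelation μ t := fun t => by
    unfold currentCorrelation
    exact tsum_congr fun x => integral_congr_ae (hint t x)
  refine ⟨D', hcar, hon, hoff, hpres, hae, hcorr, fun t => ?_⟩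
  unfold HasAbsConvergentCorrelation
  have h1 : ∀ x : ℤ, Integrable (fun σ => P.bondCurrentZ σ 0 * P.bondCurrentZ (D'.flow t σ) x) μ ↔
      Integrable (fun σ => P.bondCurrentZ σ 0 * P.bondCurrentZ (D.flow t σ) x) μ := fun x =>
    integrable_congr (hint t x)
  have h2 : (fun x : ℤ => |∫ σ, P.bondCurrentZ σ 0 * P.bondCurrentZ (D'.flow t σ) x ∂μ|) =
      fun x : ℤ => |∫ σ, P.bondCurrentZ σ 0 * P.bondCurrentZ (D.flow t σ) x ∂μ| :=
    funext fun x => by rw [integral_congr_ae (hint t x)]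
  simp only [h1, h2]

/-- **Normal form of a `𝒳₀`-dynamics.** For `U`, `V` measurable and a dynamics with carrier
Buttà–Marchioro's good set `𝒳₀ = bmGood P` preserving `μ`: there is a dynamics with carrier `𝒳₀`,
identity off `𝒳₀`, the same flow on `𝒳₀`, preserving `μ`, with the same `currentCorrelation μ` and
the same `HasAbsConvergentCorrelation μ t` at every `t`. [folklore] -/
theorem exists_normalForm_bmGood (hUm : Measurable P.U) (hVm : Measurable P.V)
    (hcar : D.carrier = P.bmGood) {μ : Measure ChainConfig} (hD : D.PreservesMeasure μ) :
    ∃ D' : InfiniteChainDynamics P, D'.carrier = P.bmGood ∧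
      (∀ (t : ℝ) (σ : ChainConfig), σ ∈ P.bmGood → D'.flow t σ = D.flow t σ) ∧
      (∀ (t : ℝ) (σ : ChainConfig), σ ∉ P.bmGood → D'.flow t σ = σ) ∧
      D'.PreservesMeasure μ ∧
      (∀ t : ℝ, D'.currentCorrelation μ t = D.currentCorrelation μ t) ∧
      ∀ t : ℝ, D'.HasAbsConvergentCorrelation μ t ↔ D.HasAbsConvergentCorrelation μ t := by
  have hC : MeasurableSet D.carrier := by
    rw [hcar]; exact P.measurableSet_bmGood hUm hVm
  obtain ⟨D', hcar', hon, hoff, hpres, -, hcorr, habs⟩ := D.exists_normalForm_preservesMeasure hC hD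
  rw [hcar] at hcar' hon hoff
  exact ⟨D', hcar', hon, hoff, hpres, hcorr, habs⟩

/-- **Normal form of a `𝒳₀`-dynamics of the pinned anharmonic chain** (`U = ω₂q²/2 + lam q⁴/4`,
`V = r²/2 + βr⁴/4` are continuous, hence measurable): the conclusion of `exists_normalForm_bmGood`
with the measurability hypotheses discharged. [folklore] -/
theorem exists_normalForm_pinnedChain {ω₂ lam β γ : ℝ}
    (D : InfiniteChainDynamics (pinnedChain ω₂ lam β γ))
    (hcar : D.carrier = (pinnedChain ω₂ lam β γ).bmGood) {μ : Measure ChainConfig}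
    (hD : D.PreservesMeasure μ) :
    ∃ D' : InfiniteChainDynamics (pinnedChain ω₂ lam β γ), D'.carrier = (pinnedChain ω₂ lam β γ).bmGood ∧
      (∀ (t : ℝ) (σ : ChainConfig), σ ∈ (pinnedChain ω₂ lam β γ).bmGood → D'.flow t σ = D.flow t σ) ∧
      (∀ (t : ℝ) (σ : ChainConfig), σ ∉ (pinnedChain ω₂ lam β γ).bmGood → D'.flow t σ = σ) ∧
      D'.PreservesMeasure μ ∧
      (∀ t : ℝ, D'.currentCorrelation μ t = D.currentCorrelation μ t) ∧
      ∀ t : ℝ, D'.HasAbsConvergentCorrelation μ t ↔ D.HasAbsConvergentCorrelation μ t := by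
  have hUc : Continuous (pinnedChain ω₂ lam β γ).U := by
    show Continuous fun q : ℝ => ω₂ * q ^ 2 / 2 + lam * q ^ 4 / 4
    fun_prop
  have hVc : Continuous (pinnedChain ω₂ lam β γ).V := by
    show Continuous fun r : ℝ => r ^ 2 / 2 + β * r ^ 4 / 4
    fun_prop
  exact D.exists_normalForm_bmGood hUc.measurable hVc.measurable hcar hD

end InfiniteChainDynamics

end Literature.MathematicalPhysics.KineticTheory.HeatConduction

end
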